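import Summits.BirchSwinnertonDyer.BirchSwinnertonDyer.Theorems.ThetaPartnerAtTwoSignedKatoUpToAtTwoLayerLocalTrivialityFinite
import Literature.NumberTheory.GaloisRepresentations.ContinuousShapiroLiftVanishing
import Literature.NumberTheory.GaloisRepresentations.ContinuousCupProductCompat
import Literature.NumberTheory.GaloisCohomology.PoitouTate
import HarnessLib

/-!
# Route `ThetaPartnerAtTwo` (TP2), crux K3 `SignedKatoDivisibilityUpToAtTwo` (item stmt-BirchSwinnertonDyer-20308) /
# K3P′ (item 25631), line `colemanrat` v7 — (PT-orth) brick [S2-V]: in the SHAPIRO model over `Γ_K`, the localisation at a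
# place `v ∤ p` of the global cup class `a ∪ Sh_{Γ_N}^{Γ_K}[ψ]` VANISHES for a layer Selmer cocycle `ψ` (finite coefficients)

Lead `bsd-wall-tp2-p2x` g5 (cell `bsd-wall`). HONEST FRAMING: THEOREMS ONLY (no definition, no named fact, no instance, no `sorry`);
closes no item; BSD is NOT proved by any of this.

The (PT-orth) clause of the research stub (R2c) is proved (lead's S2 architecture, bus 2026-08-28) by Tate's reciprocity law over `K = ℚ`
applied to the cup product `c = Sh a ∪_Σ Sh b ∈ H²(Γ_ℚ, μ_{2^K})` of the SHAPIRO LIFTS (`shapiroLift`, `Maps(Γ_ℚ ⧸ Γ_N, E[2^K])`) of a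
layer class `a` and of a finite-level layer Selmer cocycle `b = [ψ]`, for the summed Weil pairing. This file kills the local terms at the
finite places `v ∤ p`: the restriction of `Sh[ψ]` along `Γ_{K_v} → Γ_K` is ZERO — by the generic orbit-by-orbit coboundary
`ContinuousShapiroLiftVanishing.map_shapiroLift_eq_zero_of_reps`, fed with the conjugate local principal vectors of
`…LayerLocalTrivialityFinite.exists_level_forall_conj_apply_eq_smul_sub` — hence so is the restriction of every cup product with it
(`ContPairing.cupProduct_res`), whatever the pairing and the other factor.

## What is proved (generic: any number field `K`, open subgroup `U ≤ Γ_K` with coset representatives, any `TopRep`s and pairing)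
* `map_shapiroLift_eq_zero_of_decomp` — `res_v (Sh_U [ψ]) = 0` in `H¹(Γ_{K_v}, Maps(Γ_K ⧸ U, X)|)` when, for every representative `s(y₀)`,
  `d ↦ ψ(s(y₀)⁻¹ d s(y₀))` is principal on `D_v`-elements (`d ∈ decomp v`).
* `map_cupProduct_shapiroLift_eq_zero_of_decomp` — hence `res_v (a ∪ Sh_U [ψ]) = 0` in `H²(Γ_{K_v}, Z|)` for every continuous pairing
  `P : A × Maps(Γ_K ⧸ U, X) → Z` and every `a ∈ H¹(Γ_K, A)`.
* `localization_cupProduct_shapiroLift_eq_zero_of_selmerLayer` — the K3 form: `U = Γ_N` a layer of a `ℤ_p`-extension, `X = E[p^{K'}]`,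
  `ψ` a finite-level lift of a cocycle of a class of `Sel_{p^∞}(E/K_N)`, `K'` large (`…LayerLocalTrivialityFinite`), `v ∤ p`, `Z = μ_n`:
  the LOCALISATION (`galoisCohomology.localization`, the Poitou–Tate dialect) of the cup class vanishes, so its invariant `inv_v` is `0`.

References: [NeukirchSchmidtWingberg2008] I §4 (1.4.2), I §5 (1.5.6)–(1.5.7), I §6 Prop. (1.6.4); [MilneADT2006] I Thm. 4.10;
[Kobayashi2003] (7.16)–(7.21) (p. 12); [GreenbergLNM1716] §2 Prop. 2.1 (p. 72).
-/

set_option autoImplicit false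
-- the Theorems namespace of this sub repeats the summit name by design (D-0017 nested layout)
set_option linter.dupNamespace false

noncomputable section

open scoped Classical

namespace Summit.BirchSwinnertonDyer.BirchSwinnertonDyer.Theorems

namespace SignedKatoOffTwo.LayerShapiro

open CategoryTheory NumberField IsDedekindDomain Field WeierstrassCurve
  Literature.NumberTheory.EllipticCurves Literature.NumberTheory.EllipticCurves.GreenbergSelmer
  Literature.NumberTheory.GaloisRepresentations Literature.NumberTheory.GaloisCohomology ZpExtension

-- cup products need `LocallyCompactSpace Γ`: the compactness of the absolute Galois groups (tree theorem
-- `absoluteGaloisGroup_compactSpace`) is taken as an instance ARGUMENT of the statements below (supply it with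
-- `haveI := absoluteGaloisGroup_compactSpace K`), so that no instance attribute is declared in this file.

universe u

section Generic

variable {K : Type u} [Field K] [NumberField K] (X : TopRep.{u} ℤ (absoluteGaloisGroup K))
  (U : Subgroup (absoluteGaloisGroup K)) (hU : IsOpen (U : Set (absoluteGaloisGroup K)))
  {s : absoluteGaloisGroup K ⧸ U → absoluteGaloisGroup K} (hs : ∀ x, (s x : absoluteGaloisGroup K ⧸ U) = x)
  (hs1 : s ((1 : absoluteGaloisGroup K) : absoluteGaloisGroup K ⧸ U) = 1) (v : HeightOneSpectrum (𝓞 K))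

/-- **`res_v (Sh_U [ψ]) = 0`** in `H¹(Γ_{K_v}, Maps(Γ_K ⧸ U, X)|)` (restriction along `absGaloisRestrict K K_v`, identity on coefficients) as soon as,
for every coset representative `s(y₀)`, the crossed homomorphism `d ↦ ψ(s(y₀)⁻¹ d s(y₀))` is principal on the decomposition group
`D_v = range(Γ_{K_v} → Γ_K)` (`decomp v`). [cite: NeukirchSchmidtWingberg2008, I §5 (1.5.6)–(1.5.7) and I §6 Prop. (1.6.4)] -/
theorem map_shapiroLift_eq_zero_of_decomp [Fintype (absoluteGaloisGroup K ⧸ U)] (ψ : contOneCocycles (subgroupRep X U))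
    (hloc : ∀ y₀ : absoluteGaloisGroup K ⧸ U, ∃ b : X, ∀ d : absoluteGaloisGroup K, d ∈ decomp v →
      ∀ hd : (s y₀)⁻¹ * d * s y₀ ∈ U, ψ.1 ⟨(s y₀)⁻¹ * d * s y₀, hd⟩ = X.ρ ((s y₀)⁻¹ * d * s y₀) b - b) :
    ContinuousCohomology.map (absGaloisRestrict K (v.adicCompletion K))
        (𝟙 (TopRep.res (absGaloisRestrict K (v.adicCompletion K) :
          absoluteGaloisGroup (v.adicCompletion K) →* absoluteGaloisGroup K) (coindFin X U))) 1
      (shapiroLift X U hU hs hs1 (oneCocycleClass _ ψ)) = 0 := by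
  refine map_shapiroLift_eq_zero_of_reps X U hU (absGaloisRestrict K (v.adicCompletion K)) hs hs1 ψ fun y₀ ↦ ?_
  obtain ⟨b, hb⟩ := hloc y₀
  exact ⟨b, fun d hd ↦ hb _ ((mem_decomp_iff v _).mpr ⟨d, rfl⟩) hd⟩

variable {A Z : TopRep.{u} ℤ (absoluteGaloisGroup K)}

/-- **`res_v (a ∪ Sh_U [ψ]) = 0`** in `H²(Γ_{K_v}, Z|)` for EVERY continuous equivariant pairing `P : A × Maps(Γ_K ⧸ U, X) → Z` and every
`a ∈ H¹(Γ_K, A)`, under the hypothesis of `map_shapiroLift_eq_zero_of_decomp` (`res (a ∪ b) = res a ∪ res b`, `ContPairing.cupProduct_res`).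
[cite: NeukirchSchmidtWingberg2008, I §4 (1.4.2)] -/
theorem map_cupProduct_shapiroLift_eq_zero_of_decomp [CompactSpace (absoluteGaloisGroup K)]
    [CompactSpace (absoluteGaloisGroup (v.adicCompletion K))] [Fintype (absoluteGaloisGroup K ⧸ U)]
    (P : ContPairing A (coindFin X U) Z)
    (a : continuousCohomology 1 A) (ψ : contOneCocycles (subgroupRep X U))
    (hloc : ∀ y₀ : absoluteGaloisGroup K ⧸ U, ∃ b : X, ∀ d : absoluteGaloisGroup K, d ∈ decomp v →
      ∀ hd : (s y₀)⁻¹ * d * s y₀ ∈ U, ψ.1 ⟨(s y₀)⁻¹ * d * s y₀, hd⟩ = X.ρ ((s y₀)⁻¹ * d * s y₀) b - b) :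
    ContinuousCohomology.map (absGaloisRestrict K (v.adicCompletion K))
        (𝟙 (TopRep.res (absGaloisRestrict K (v.adicCompletion K) :
          absoluteGaloisGroup (v.adicCompletion K) →* absoluteGaloisGroup K) Z)) 2
      (P.cupProduct a (shapiroLift X U hU hs hs1 (oneCocycleClass _ ψ))) = 0 := by
  rw [ContPairing.cupProduct_res, map_shapiroLift_eq_zero_of_decomp X U hU hs hs1 v ψ hloc, map_zero]

end Generic

/-! ## The K3 form: layer Selmer cocycles of a `ℤ_p`-extension, coefficients `E[p^{K'}]`, values in `μ_n`, Poitou–Tate dialect -/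

section Selmer

variable {K : Type u} [Field K] [NumberField K] (W : WeierstrassCurve K) [W.IsElliptic] {p : ℕ} [hp : Fact p.Prime]
  (κ : ZpExtension K p) (N : ℕ)
  {s : absoluteGaloisGroup K ⧸ κ.layerSubgroup N → absoluteGaloisGroup K}
  (hs : ∀ x, (s x : absoluteGaloisGroup K ⧸ κ.layerSubgroup N) = x)
  (hs1 : s ((1 : absoluteGaloisGroup K) : absoluteGaloisGroup K ⧸ κ.layerSubgroup N) = 1)
  (v : HeightOneSpectrum (𝓞 K))

/-- **The local term at `v ∤ p` of the Shapiro cup class of a layer Selmer cocycle vanishes — already as a CLASS.** Let `t ∈ Sel_{p^∞}(E/K_N)`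
with a cocycle `φ_N`, and `v ∤ p`. There is `j` such that for every level `K' ≥ j`, every finite-level lift `ψ : Γ_N → E[p^{K'}]` of `φ_N`
(`…LayerLocalTrivialityFinite.exists_torsionCocycle_of_pow_nsmul_eq_zero`), every `Γ_K`-representation `A`, every continuous equivariant
pairing `P : A × Maps(Γ_K ⧸ Γ_N, E[p^{K'}]) → μ_n(K̄)` (e.g. the summed Weil pairing with `A = Maps(Γ_K ⧸ Γ_N, E[p^{K'}])`) and every `a ∈ H¹(Γ_K, A)`:
`loc_v (a ∪ Sh_{Γ_N}[ψ]) = 0` in `H²(K_v, μ_n)` (the tree's `galoisCohomology.localization`, whose `inv_v` enters Tate's reciprocity law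
`sumInvLocalizationEqZero_canonical_of_numberField`). [cite: Kobayashi2003, (7.16)–(7.21) (p. 12)] [cite: MilneADT2006, Ch. I, Thm. 4.10]
[cite: GreenbergLNM1716, §2 Prop. 2.1 (p. 72)] -/
theorem localization_cupProduct_shapiroLift_eq_zero_of_selmerLayer [CompactSpace (absoluteGaloisGroup K)]
    [CompactSpace (absoluteGaloisGroup (v.adicCompletion K))] (n : ℕ) [NeZero n]
    {t : W.subgroupH1 p (κ.layerSubgroup N)} (ht : t ∈ W.selmerLayer κ N) (hpv : ((p : ℕ) : 𝓞 K) ∉ v.asIdeal)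
    (φN : contOneCocycles (discreteTopRep (κ.layerSubgroup N) (W.geomPrimaryTorsion p))) (hφN : oneCocycleClass _ φN = t) :
    ∃ j : ℕ, ∀ K' : ℕ, j ≤ K' →
      ∀ ψ : contOneCocycles (subgroupRep (W.torsionGaloisModule ((p : ℤ) ^ K')).toTopRep (κ.layerSubgroup N)),
        (∀ x, ((ψ.1 x : geomTorsion W ((p : ℤ) ^ K')) : W.geomPoints) = ((φN.1 x : W.geomPrimaryTorsion p) : W.geomPoints)) →
        ∀ (A : TopRep.{u} ℤ (absoluteGaloisGroup K))
          (P : ContPairing A (coindFin (W.torsionGaloisModule ((p : ℤ) ^ K')).toTopRep (κ.layerSubgroup N))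
            (DiscreteGaloisModule.mu K n).toTopRep)
          (a : continuousCohomology 1 A) [Fintype (absoluteGaloisGroup K ⧸ κ.layerSubgroup N)],
          galoisCohomology.localization (DiscreteGaloisModule.mu K n) (Sum.inr v) 2
            (P.cupProduct a (shapiroLift (W.torsionGaloisModule ((p : ℤ) ^ K')).toTopRep (κ.layerSubgroup N)
              (κ.isOpen_layerSubgroup N) hs hs1 (oneCocycleClass _ ψ))) = 0 := by
  obtain ⟨j, hj⟩ := LayerFinite.exists_level_forall_conj_apply_eq_smul_sub W κ v N ht hpv s φN hφN
  refine ⟨j, fun K' hK' ψ hψ A P a _ ↦ ?_⟩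
  exact map_cupProduct_shapiroLift_eq_zero_of_decomp (W.torsionGaloisModule ((p : ℤ) ^ K')).toTopRep (κ.layerSubgroup N)
    (κ.isOpen_layerSubgroup N) hs hs1 v P a ψ fun y₀ ↦ hj K' hK' ψ hψ y₀

end Selmer

end SignedKatoOffTwo.LayerShapiro

end Summit.BirchSwinnertonDyer.BirchSwinnertonDyer.Theorems

end
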